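import Literature.Probability.LatticeModels.NishimoriPathIdentity
import HarnessLib

/-!
# Garban–Spencer's path estimator: long-range order from a path ensemble with small overlaps

C. Garban, T. Spencer, J. Math. Phys. **63** (2022) 093302 = arXiv:2109.01617, §2, proof of
Theorem 1.3, Step 1 ((2.9)–(2.10)), Lemma 2.5 and Remark 1 — the *deterministic* part: given any
probability measure `ν = (w_s)` on unit chains (simple paths) `T_s` from `x` to `y`, the estimator

  `R(u) = ∑_s w_s λ^{-|T_s|} U_{T_s}(u)`   ((2.9))

satisfies `𝔼_β[⟨θ̄_x θ_y⟩_u R(u)] = 1` ((2.10)) and `𝔼_β[R] = 1` (path identity (2.8)), and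
`𝔼_β[|R|²] ≤ 𝔼_{ν⊗ν}[λ^{-2 |p₁ ∩ p₂|}]` (first display of the proof of Lemma 2.5), whence

  `1 − 𝔼_β[⟨cos(θ(x) − θ(y))⟩_{u,β}] ≤ 𝔼_β[|R − 1|] ≤ (𝔼_β|R|² − 1)^{1/2}
     ≤ (∑_{s,s'} w_s w_{s'} λ^{-2·overlap(T_s,T_{s'})} − 1)^{1/2}`

(`one_sub_nishimoriAvg_expect_cosDiff_le`), and by the Messager–Miracle-Solé–Pfister inequality
(Remark 1) the same lower bound for the PURE XY model on the bond system
(`one_sub_expect_one_cosDiff_le`): for every `β > 0`, all `x, y` and every such ensemble,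

  `⟨cos(θ(x) − θ(y))⟩_{ω ≡ 0, β} ≥ 1 − (∑_{s,s'} w_s w_{s'} (λ(β)^{-2})^{overlap(T_s,T_{s'})} − 1)^{1/2}`.

What remains for Theorem 1.3 itself is the *existence* of ensembles with uniformly small overlap
moment in `ℤ^d`, `d ≥ 3` (unpredictable paths, Thm. 2.4 of the source) and `λ^{-2} ≤ 1 + O(β⁻¹)`
(`inv_vonMisesMean_le`); those are separate files.

## References

* C. Garban, T. Spencer, J. Math. Phys. 63 (2022) 093302, arXiv:2109.01617, §2: (2.9), (2.10),
  Lemma 2.5 and the display after it, Remark 1. [GarbanSpencer2022]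
-/

noncomputable section

open MeasureTheory Finset TopologicalSpace
open scoped BigOperators ComplexConjugate

namespace Literature.Probability.LatticeModels

namespace BondSystem

variable {V ι : Type*} (G : BondSystem V ι) [Fintype ι] [Fintype V]
  [MeasurableSpace Circle] [BorelSpace Circle] {x y : V}
  {S : Type*} [Fintype S]

/-! ### The estimator `R` -/

/-- **Garban–Spencer's estimator (2.9)**: `R(u) = ∑_s w_s λ^{-|T_s|₁} U_{T_s}(u)`, the
`ν`-average over the path ensemble of the length-renormalised disorder holonomies.
[cite: GarbanSpencer2022, (2.9)] -/
def estimator (β : ℝ) (w : S → ℝ) (T : S → G.UnitChain x y) (u : ι → Circle) : ℂ :=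
  ∑ s, (w s * (vonMisesMean β)⁻¹ ^ (T s).length : ℝ) * (T s).holonomy u

omit [Fintype V] [MeasurableSpace Circle] [BorelSpace Circle] in
/-- The estimator is continuous in the disorder. [folklore] -/
theorem continuous_estimator [MeasurableSpace Circle] [BorelSpace Circle] (β : ℝ) (w : S → ℝ)
    (T : S → G.UnitChain x y) : Continuous (G.estimator β w T) :=
  continuous_finsetSum _ fun s _ => continuous_const.mul (T s).continuous_holonomy

omit [Fintype V] in
/-- **`𝔼_β[R] = 1`** for probability weights (by `𝔼_β[U_T] = λ^{|T|₁}`). [cite: GarbanSpencer2022, display after (2.10)] -/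
theorem nishimoriAvg_estimator {β : ℝ} (hβ : 0 < β) (w : S → ℝ) (hw1 : ∑ s, w s = 1)
    (T : S → G.UnitChain x y) : nishimoriAvg β (G.estimator β w T) = 1 := by
  have hl := (vonMisesMean_pos hβ).ne'
  unfold estimator
  rw [nishimoriAvg_finset_sum β Finset.univ
    (Φ := fun s u => ((w s * (vonMisesMean β)⁻¹ ^ (T s).length : ℝ) : ℂ) * (T s).holonomy u)
    fun s _ => continuous_const.mul (T s).continuous_holonomy]
  simp_rw [nishimoriAvg_const_mul, G.nishimoriAvg_holonomy hβ]
  rw [← Complex.ofReal_one, ← hw1, Complex.ofReal_sum]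
  refine Finset.sum_congr rfl fun s _ => ?_
  push_cast
  rw [mul_assoc, ← mul_pow, inv_mul_cancel₀ (by exact_mod_cast hl), one_pow, mul_one]

/-- **Garban–Spencer (2.10)**: `𝔼_β[⟨θ̄_x θ_y⟩_{u,β} R(u)] = 1` for probability weights.
[cite: GarbanSpencer2022, (2.10)] -/
theorem nishimoriAvg_cexpect_mul_estimator {β : ℝ} (hβ : 0 < β) (w : S → ℝ) (hw1 : ∑ s, w s = 1)
    (T : S → G.UnitChain x y) :
    nishimoriAvg β (fun u => G.cexpect β u (fun θ => ((diffChar x y θ : Circle) : ℂ)) *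
      G.estimator β w T u) = 1 := by
  have hl := (vonMisesMean_pos hβ).ne'
  have hc : Continuous fun u => G.cexpect β u (fun θ => ((diffChar x y θ : Circle) : ℂ)) :=
    G.continuous_cexpect β (continuous_subtype_val.comp
      ((map_continuous (diffChar x y)).comp continuous_snd))
  unfold estimator
  simp_rw [Finset.mul_sum]
  rw [nishimoriAvg_finset_sum β Finset.univ
    (Φ := fun s u => G.cexpect β u (fun θ => ((diffChar x y θ : Circle) : ℂ)) *
      (((w s * (vonMisesMean β)⁻¹ ^ (T s).length : ℝ) : ℂ) * (T s).holonomy u))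
    fun s _ => hc.mul (continuous_const.mul (T s).continuous_holonomy)]
  have e : ∀ s (u : ι → Circle), G.cexpect β u (fun θ => ((diffChar x y θ : Circle) : ℂ)) *
      (((w s * (vonMisesMean β)⁻¹ ^ (T s).length : ℝ) : ℂ) * (T s).holonomy u) =
      ((w s * (vonMisesMean β)⁻¹ ^ (T s).length : ℝ) : ℂ) *
        (G.cexpect β u (fun θ => ((diffChar x y θ : Circle) : ℂ)) * (T s).holonomy u) := by
    intro s u; ring
  simp_rw [e, nishimoriAvg_const_mul, G.nishimoriAvg_cexpect_diff_mul_holonomy hβ]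
  rw [← Complex.ofReal_one, ← hw1, Complex.ofReal_sum]
  refine Finset.sum_congr rfl fun s _ => ?_
  push_cast
  rw [mul_assoc, ← mul_pow, inv_mul_cancel₀ (by exact_mod_cast hl), one_pow, mul_one]

omit [Fintype V] in
/-- **The second moment of the estimator (Lemma 2.5, first display)**:
`𝔼_β[|R|²] ≤ ∑_{s,s'} w_s w_{s'} λ^{-2 overlap(T_s, T_{s'})}` for non-negative weights.
[cite: GarbanSpencer2022, proof of Lemma 2.5, first display] -/
theorem nishimoriAvg_norm_sq_estimator_le {β : ℝ} (hβ : 0 < β) (w : S → ℝ) (hw : ∀ s, 0 ≤ w s)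
    (T : S → G.UnitChain x y) :
    nishimoriAvg β (fun u => ‖G.estimator β w T u‖ ^ 2) ≤
      ∑ s, ∑ s', w s * w s' * ((vonMisesMean β) ^ 2)⁻¹ ^ (T s).overlap (T s') := by
  have hl := vonMisesMean_pos hβ
  set c : S → ℝ := fun s => w s * (vonMisesMean β)⁻¹ ^ (T s).length with hc
  have hc0 : ∀ s, 0 ≤ c s := fun s => mul_nonneg (hw s) (pow_nonneg (inv_nonneg.2 hl.le) _)
  -- |R|² = Re (R R̄) = Re ∑∑ c c' U_s Ū_{s'}
  have hsq : ∀ u, ‖G.estimator β w T u‖ ^ 2 =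
      (∑ s, ∑ s', ((c s * c s' : ℝ) : ℂ) * ((T s).holonomy u * conj ((T s').holonomy u))).re := by
    intro u
    have hn : (Complex.normSq (G.estimator β w T u) : ℝ) =
        (G.estimator β w T u * conj (G.estimator β w T u)).re := by
      rw [Complex.mul_conj, Complex.ofReal_re]
    rw [← Complex.normSq_eq_norm_sq, hn]
    congr 1
    rw [estimator, map_sum, Finset.sum_mul_sum]
    simp only [hc]
    refine Finset.sum_congr rfl fun s _ => Finset.sum_congr rfl fun s' _ => ?_
    rw [map_mul, Complex.conj_ofReal]
    push_cast
    ring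
  have hcont : ∀ s s', Continuous fun u : ι → Circle =>
      ((c s * c s' : ℝ) : ℂ) * ((T s).holonomy u * conj ((T s').holonomy u)) := fun s s' =>
    continuous_const.mul ((T s).continuous_holonomy.mul
      (Complex.continuous_conj.comp (T s').continuous_holonomy))
  simp_rw [hsq]
  rw [← re_nishimoriAvg β (continuous_finsetSum _ fun s _ => continuous_finsetSum _ fun s' _ => hcont s s'),
    nishimoriAvg_finset_sum β _ (fun s _ => continuous_finsetSum _ fun s' _ => hcont s s'),
    Complex.re_sum]
  refine Finset.sum_le_sum fun s _ => ?_
  rw [nishimoriAvg_finset_sum β _ (fun s' _ => hcont s s'), Complex.re_sum]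
  refine Finset.sum_le_sum fun s' _ => ?_
  obtain ⟨m, hm0, hm1, hm⟩ := G.nishimoriAvg_holonomy_mul_conj hβ (T s) (T s')
  rw [nishimoriAvg_const_mul, hm, ← Complex.ofReal_mul, Complex.ofReal_re]
  -- c c' m ≤ c c' λ^{sd} = w w' λ^{-2 ov}
  calc c s * c s' * m ≤ c s * c s' * vonMisesMean β ^ (T s).symmDiffCard (T s') :=
        mul_le_mul_of_nonneg_left hm1 (mul_nonneg (hc0 s) (hc0 s'))
    _ = w s * w s' * ((vonMisesMean β) ^ 2)⁻¹ ^ (T s).overlap (T s') := by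
        have hlen := (T s).length_add_length (T s')
        have key : (vonMisesMean β)⁻¹ ^ (T s).length * (vonMisesMean β)⁻¹ ^ (T s').length =
            (vonMisesMean β)⁻¹ ^ (T s).symmDiffCard (T s') *
              ((vonMisesMean β) ^ 2)⁻¹ ^ (T s).overlap (T s') := by
          rw [← pow_add, hlen, pow_add, pow_mul, inv_pow (vonMisesMean β) 2]
        have k2 : (vonMisesMean β)⁻¹ ^ (T s).symmDiffCard (T s') *
            vonMisesMean β ^ (T s).symmDiffCard (T s') = 1 := by
          rw [← mul_pow, inv_mul_cancel₀ hl.ne', one_pow]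
        simp only [hc]
        calc w s * (vonMisesMean β)⁻¹ ^ (T s).length * (w s' * (vonMisesMean β)⁻¹ ^ (T s').length) *
              vonMisesMean β ^ (T s).symmDiffCard (T s')
            = w s * w s' * (((vonMisesMean β)⁻¹ ^ (T s).length * (vonMisesMean β)⁻¹ ^ (T s').length) *
                vonMisesMean β ^ (T s).symmDiffCard (T s')) := by ring
          _ = w s * w s' * (((vonMisesMean β)⁻¹ ^ (T s).symmDiffCard (T s') *
                vonMisesMean β ^ (T s).symmDiffCard (T s')) *
                ((vonMisesMean β) ^ 2)⁻¹ ^ (T s).overlap (T s')) := by rw [key]; ring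
          _ = _ := by rw [k2, one_mul]

/-! ### The lower bound on the two-point function -/

/-- **Garban–Spencer, end of Step 1**: for every `β > 0`, every pair of vertices and every path
ensemble (probability weights `w` on unit chains `T_s` from `x` to `y`),
`1 − 𝔼^{XY}_β[⟨cos(θ(x) − θ(y))⟩_{u,β}] ≤ (∑_{s,s'} w_s w_{s'} λ^{-2 overlap(T_s,T_{s'})} − 1)^{1/2}`
("`1 − 𝔼⟨cos⟩ ≤ 𝔼|R − 1| ≤ 𝔼[|R|² − 1]^{1/2}` since `𝔼 R = 1`").
[cite: GarbanSpencer2022, proof of Theorem 1.3, Step 1, display after Lemma 2.5] -/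
theorem one_sub_nishimoriAvg_expect_cosDiff_le {β : ℝ} (hβ : 0 < β) (w : S → ℝ)
    (hw : ∀ s, 0 ≤ w s) (hw1 : ∑ s, w s = 1) (T : S → G.UnitChain x y) :
    1 - nishimoriAvg β (fun u => G.expect β u (cosDiff x y)) ≤
      Real.sqrt (∑ s, ∑ s', w s * w s' * ((vonMisesMean β) ^ 2)⁻¹ ^ (T s).overlap (T s') - 1) := by
  set R := G.estimator β w T with hR
  set C : (ι → Circle) → ℂ := fun u => G.cexpect β u (fun θ => ((diffChar x y θ : Circle) : ℂ)) with hC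
  have hRc : Continuous R := G.continuous_estimator β w T
  have hdc : Continuous (Function.uncurry fun (_ : ι → Circle) (θ : V → Circle) =>
      ((diffChar x y θ : Circle) : ℂ)) :=
    continuous_subtype_val.comp ((map_continuous (diffChar x y)).comp continuous_snd)
  have hCc : Continuous C := G.continuous_cexpect β hdc
  have hC1 : ∀ u, ‖C u‖ ≤ 1 := fun u =>
    G.norm_cexpect_le β u _ fun θ => (Circle.norm_coe _).le
  -- the real two-point function is the real part of `C`
  have hre : ∀ u, G.expect β u (cosDiff x y) = (C u).re := by
    intro u
    rw [hC, G.re_cexpect β u (F := fun θ => ((diffChar x y θ : Circle) : ℂ))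
      (continuous_subtype_val.comp (map_continuous (diffChar x y)))]
    congr 1; funext θ; exact cosDiff_eq_reChar x y θ
  -- 1 − 𝔼 Re C = Re 𝔼[C (R − 1)]
  have h1 : 1 - nishimoriAvg β (fun u => G.expect β u (cosDiff x y)) =
      (nishimoriAvg β (fun u => C u * (R u - 1))).re := by
    simp_rw [hre, mul_sub, mul_one]
    rw [nishimoriAvg_sub β (Φ := fun u => C u * R u) (Ψ := C) (hCc.mul hRc) hCc, Complex.sub_re,
      hR, hC, G.nishimoriAvg_cexpect_mul_estimator hβ w hw1 T, Complex.one_re, ← hC,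
      ← re_nishimoriAvg β hCc]
  -- Re 𝔼[C(R−1)] ≤ 𝔼 |R − 1|
  have h2 : (nishimoriAvg β (fun u => C u * (R u - 1))).re ≤ nishimoriAvg β (fun u => ‖R u - 1‖) := by
    refine (Complex.re_le_norm _).trans ((norm_nishimoriAvg_le β _).trans ?_)
    refine nishimoriAvg_mono β (Φ := fun u => ‖C u * (R u - 1)‖) (Ψ := fun u => ‖R u - 1‖)
      ((hCc.mul (hRc.sub continuous_const)).norm) (hRc.sub continuous_const).norm fun u => ?_
    rw [norm_mul]
    exact mul_le_of_le_one_left (norm_nonneg _) (hC1 u)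
  -- 𝔼|R − 1|² ≤ 𝔼|R|² − 1 (Jensen, and 𝔼 R = 1)
  have h3 : nishimoriAvg β (fun u => ‖R u - 1‖) ^ 2 ≤ nishimoriAvg β (fun u => ‖R u‖ ^ 2) - 1 := by
    refine (nishimoriAvg_sq_le β (g := fun u => ‖R u - 1‖) (hRc.sub continuous_const).norm).trans_eq ?_
    have e : (fun u => ‖R u - 1‖ ^ 2) = fun u => (‖R u‖ ^ 2 - 2 * (R u).re) + 1 := by
      funext u
      rw [← Complex.normSq_eq_norm_sq, ← Complex.normSq_eq_norm_sq, Complex.normSq_sub]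
      simp only [map_one, mul_one]
      ring
    rw [e, nishimoriAvg_add β (Φ := fun u => ‖R u‖ ^ 2 - 2 * (R u).re) (Ψ := fun _ => (1 : ℝ))
        ((hRc.norm.pow 2).sub (continuous_const.mul (Complex.continuous_re.comp hRc))) continuous_const,
      nishimoriAvg_sub β (Φ := fun u => ‖R u‖ ^ 2) (Ψ := fun u => 2 * (R u).re) (hRc.norm.pow 2)
        (continuous_const.mul (Complex.continuous_re.comp hRc)),
      nishimoriAvg_const_mul_real β 2 (fun u => (R u).re), ← re_nishimoriAvg β hRc, hR,
      G.nishimoriAvg_estimator hβ w hw1 T, nishimoriAvg_const]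
    norm_num; ring
  have h4 := G.nishimoriAvg_norm_sq_estimator_le hβ w hw T
  rw [← hR] at h4
  have h0 : 0 ≤ nishimoriAvg β (fun u => ‖R u - 1‖) := by
    unfold nishimoriAvg
    exact integral_nonneg fun u => smul_nonneg (nishimoriDensity_pos β u).le (norm_nonneg _)
  rw [h1]
  calc (nishimoriAvg β (fun u => C u * (R u - 1))).re ≤ nishimoriAvg β (fun u => ‖R u - 1‖) := h2
    _ = Real.sqrt (nishimoriAvg β (fun u => ‖R u - 1‖) ^ 2) := (Real.sqrt_sq h0).symm
    _ ≤ Real.sqrt (nishimoriAvg β (fun u => ‖R u‖ ^ 2) - 1) := Real.sqrt_le_sqrt h3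
    _ ≤ _ := Real.sqrt_le_sqrt (by linarith [h4])

/-- **Garban–Spencer, Theorem 1.3 ∘ Remark 1, deterministic part.** For the pure XY model
(`ω ≡ 0`) on any finite bond system at `β > 0`, any two vertices `x, y` and any path ensemble
(probability weights `w` on unit chains `T_s` from `x` to `y`):
`⟨cos(θ(x) − θ(y))⟩_{1,β} ≥ 1 − (∑_{s,s'} w_s w_{s'} (λ(β)²)^{-overlap(T_s,T_{s'})} − 1)^{1/2}`
(Messager–Miracle-Solé–Pfister: the pure model dominates the Nishimori average, which is
bounded by the estimator). [cite: GarbanSpencer2022, Theorem 1.3 with Remark 1 and Lemma 2.5] -/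
theorem one_sub_expect_one_cosDiff_le {β : ℝ} (hβ : 0 < β) (x y : V) (w : S → ℝ)
    (hw : ∀ s, 0 ≤ w s) (hw1 : ∑ s, w s = 1) (T : S → G.UnitChain x y) :
    1 - G.expect β 1 (cosDiff x y) ≤
      Real.sqrt (∑ s, ∑ s', w s * w s' * ((vonMisesMean β) ^ 2)⁻¹ ^ (T s).overlap (T s') - 1) := by
  have hmmp : nishimoriAvg β (fun u => G.expect β u (cosDiff x y)) ≤ G.expect β 1 (cosDiff x y) := by
    refine nishimoriAvg_le_const β ?_ fun u => G.expect_cosDiff_le_expect_one hβ.le u x y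
    have hdc : Continuous (Function.uncurry fun (_ : ι → Circle) (θ : V → Circle) =>
        ((diffChar x y θ : Circle) : ℂ)) :=
      continuous_subtype_val.comp ((map_continuous (diffChar x y)).comp continuous_snd)
    have hCc := G.continuous_cexpect β hdc
    have e : (fun u => G.expect β u (cosDiff x y)) =
        fun u => (G.cexpect β u (fun θ => ((diffChar x y θ : Circle) : ℂ))).re := by
      funext u
      rw [G.re_cexpect β u (F := fun θ => ((diffChar x y θ : Circle) : ℂ))
        (continuous_subtype_val.comp (map_continuous (diffChar x y)))]
      congr 1; funext θ; exact cosDiff_eq_reChar x y θ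
    rw [e]
    exact Complex.continuous_re.comp hCc
  linarith [G.one_sub_nishimoriAvg_expect_cosDiff_le hβ w hw hw1 T]

end BondSystem

end Literature.Probability.LatticeModels
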